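import Mathlib
import Summits.Ventures.HodgeRepro.OcticCMPointInertModel

/-!
# OcticCMPointGaloisRing — the ring `𝒪/𝔮²` at the inert place `𝔮 | 2` of the octic point: `GR(4, 4)`

Blind re-derivation cell `pub-hodge-repro`, seat night-2 (gen 4, final cycle).  Target tree path
`lean/Summits/Ventures/HodgeRepro/OcticCMPointGaloisRing.lean`.  The first step beyond conductor `1` at the inert
place (`OcticCMPointInertModel.lean` is `𝒪/𝔮 = 𝔽₁₆`): the Galois ring `GR(4, 4) = 𝒪/𝔮² = ℤ/4[x]/(f)` with
`f = X⁴ + 2X² + 3X + 1`, THE Hensel lift of `X⁴ + X + 1 ∈ 𝔽₂[X]` whose roots are Teichmüller (`15`-th roots of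
unity): among the `16` monic lifts it is the only one with `x¹⁵ = 1` and `f(x⁴) = 0` (brute force,
`proofs/night-2/g4/numerics/gr44_lift.py`).

* `GR44`, `r` — the ring `AdjoinRoot f` and its generator; `r_rel` (`r⁴ = 2r² + r + 3`), `four_eq_zero`;
* `r_pow_fifteen` — **`r¹⁵ = 1`** (`r` is Teichmüller);
* `frobLift` — **the Frobenius lift `r ↦ r²`** as a `ℤ/4`-algebra endomorphism (`f(r²) = 0`), and
  `conjGR` — **the conjugation `σ = Frobenius² : r ↦ r⁴`** (`f(r⁴) = 0`), an involution (`conjGR_conjGR`);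
* `instFintypeGR44`, `card_GR44` — `|GR(4, 4)| = 256 = 16²` (the power basis `1, r, r², r³` over `ℤ/4`).

Every polynomial identity is a `linear_combination` of the defining relation and `4 = 0`, with the quotient
polynomials computed over `ℤ` (`f(X⁴) = q₁ f + 4 s₁`, `f(X²) = q₂ f + 4 s₂`, `X¹⁵ − 1 = q₃ f + 4 s₃`).

**What this is not.**  The trace to `ℤ/4`, the primitive additive character, the unit group and the conductor-`2`
Gauss sums at `𝔮` are NOT here (the next modules of this line; see `LIMITS-next-g4.md` §B).  Nothing here says
anything about the status of the Hodge conjecture for CM abelian varieties, which is NOT proved.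
-/

set_option autoImplicit false

noncomputable section

open Polynomial

namespace Summit.Ventures.HodgeRepro.PeriodCloser

namespace GaloisRing

/-- The Hensel lift `f = X⁴ + 2X² + 3X + 1 ∈ ℤ/4[X]` of `X⁴ + X + 1` with Teichmüller roots. -/
def f : (ZMod 4)[X] := X ^ 4 + 2 * X ^ 2 + 3 * X + 1

/-- `f` is monic. -/
theorem f_monic : f.Monic := by
  unfold f
  monicity!

/-- `natDegree f = 4`. -/
theorem f_natDegree : f.natDegree = 4 := by
  unfold f
  compute_degree!

/-- **The Galois ring `GR(4, 4) = 𝒪/𝔮²`**. -/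
abbrev GR44 : Type := AdjoinRoot f

/-- The generator `r` (a Teichmüller representative of a generator of `𝔽₁₆^×`). -/
abbrev r : GR44 := AdjoinRoot.root f

/-- `aeval r` of the explicit polynomial, in closed form. -/
theorem aeval_f (y : GR44) : aeval y f = y ^ 4 + 2 * y ^ 2 + 3 * y + 1 := by
  show aeval y (X ^ 4 + 2 * X ^ 2 + 3 * X + 1) = _
  simp only [map_add, map_mul, map_pow, aeval_X, map_ofNat, map_one]

/-- The defining relation `r⁴ + 2r² + 3r + 1 = 0`. -/
theorem r_rel : r ^ 4 + 2 * r ^ 2 + 3 * r + 1 = 0 := by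
  rw [← aeval_f, AdjoinRoot.aeval_eq, AdjoinRoot.mk_self]

/-- `4 = 0` in `GR(4, 4)`. -/
theorem four_eq_zero : (4 : GR44) = 0 := by
  have h : ((4 : ZMod 4) : GR44) = algebraMap (ZMod 4) GR44 4 := rfl
  have h4 : (4 : ZMod 4) = 0 := by decide
  rw [show (4 : GR44) = algebraMap (ZMod 4) GR44 4 from (map_ofNat (algebraMap (ZMod 4) GR44) 4).symm, h4,
    map_zero]

/-- **`r¹⁵ = 1`**: `X¹⁵ − 1 = q₃ f + 4 s₃` over `ℤ`. -/
theorem r_pow_fifteen : r ^ 15 = 1 := by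
  have h := r_rel
  have h4 := four_eq_zero
  linear_combination (111 + 183 * r + 33 * r ^ 2 - 49 * r ^ 3 - 30 * r ^ 4 + 5 * r ^ 5 + 12 * r ^ 6 + 3 * r ^ 7
    - 3 * r ^ 8 - 2 * r ^ 9 + r ^ 11) * h + (-28 - 129 * r - 201 * r ^ 2 - 104 * r ^ 3) * h4

/-- `f(r²) = 0`: `r²` is a root of `f` (`f(X²) = q₂ f + 4 s₂`). -/
theorem aeval_r_sq : aeval (r ^ 2) f = 0 := by
  have h := r_rel
  have h4 := four_eq_zero
  rw [aeval_f]
  linear_combination (5 - 3 * r - 2 * r ^ 2 + r ^ 4) * h + (-1 - 3 * r + r ^ 2 + 3 * r ^ 3) * h4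

/-- `f(r⁴) = 0`: `r⁴` is a root of `f` (`f(X⁴) = q₁ f + 4 s₁`). -/
theorem aeval_r_pow_four : aeval (r ^ 4) f = 0 := by
  have h := r_rel
  have h4 := four_eq_zero
  rw [aeval_f]
  linear_combination (-407 + 105 * r + 179 * r ^ 2 + 33 * r ^ 3 - 47 * r ^ 4 - 30 * r ^ 5 + 5 * r ^ 6 + 12 * r ^ 7
    + 3 * r ^ 8 - 3 * r ^ 9 - 2 * r ^ 10 + r ^ 12) * h + (102 + 279 * r + 80 * r ^ 2 - 195 * r ^ 3) * h4

/-- The root condition in the form `liftAlgHom` wants: `f.eval₂ (algebraMap) y = 0 ↔ aeval y f = 0`. -/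
theorem eval₂_of_aeval {y : GR44} (h : aeval y f = 0) :
    f.eval₂ ((Algebra.ofId (ZMod 4) GR44 : ZMod 4 →ₐ[ZMod 4] GR44) : ZMod 4 →+* GR44) y = 0 := by
  show eval₂ (algebraMap (ZMod 4) GR44) y f = 0
  rw [← Polynomial.aeval_def]
  exact h

/-- **The Frobenius lift** `φ : r ↦ r²`, a `ℤ/4`-algebra endomorphism of `GR(4, 4)`. -/
def frobLift : GR44 →ₐ[ZMod 4] GR44 :=
  AdjoinRoot.liftAlgHom f (Algebra.ofId (ZMod 4) GR44) (r ^ 2) (eval₂_of_aeval aeval_r_sq)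

/-- `φ(r) = r²`. -/
theorem frobLift_r : frobLift r = r ^ 2 := AdjoinRoot.liftAlgHom_root _ _ _ _

/-- **The conjugation** `σ = Frobenius² : r ↦ r⁴`, a `ℤ/4`-algebra endomorphism of `GR(4, 4)`. -/
def conjGR : GR44 →ₐ[ZMod 4] GR44 :=
  AdjoinRoot.liftAlgHom f (Algebra.ofId (ZMod 4) GR44) (r ^ 4) (eval₂_of_aeval aeval_r_pow_four)

/-- `σ(r) = r⁴`. -/
theorem conjGR_r : conjGR r = r ^ 4 := AdjoinRoot.liftAlgHom_root _ _ _ _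

/-- `σ = φ ∘ φ` (both are algebra maps sending `r` to `r⁴`). -/
theorem conjGR_eq_frobLift_comp : conjGR = frobLift.comp frobLift := by
  apply AdjoinRoot.algHom_ext
  rw [conjGR_r, AlgHom.comp_apply, frobLift_r, map_pow, frobLift_r]
  ring

/-- **`σ` is an involution**: `σ(σ(r)) = r¹⁶ = r`. -/
theorem conjGR_conjGR (y : GR44) : conjGR (conjGR y) = y := by
  have h : conjGR.comp conjGR = AlgHom.id (ZMod 4) GR44 := by
    apply AdjoinRoot.algHom_ext
    rw [AlgHom.comp_apply, conjGR_r, map_pow, conjGR_r, AlgHom.id_apply, ← pow_mul]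
    calc r ^ (4 * 4) = r ^ 15 * r := by ring
      _ = r := by rw [r_pow_fifteen, one_mul]
  exact AlgHom.congr_fun h y

/-- **`φ⁴ = id`**: `r¹⁶ = r`. -/
theorem frobLift_four (y : GR44) : frobLift (frobLift (frobLift (frobLift y))) = y := by
  have h2 : ∀ z, frobLift (frobLift z) = conjGR z := fun z => by
    rw [conjGR_eq_frobLift_comp, AlgHom.comp_apply]
  rw [h2, h2, conjGR_conjGR]

/-! ### Finiteness and the cardinality `256 = 16²` -/

/-- The power basis `1, r, r², r³` of `GR(4, 4)` over `ℤ/4`. -/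
def pb : PowerBasis (ZMod 4) GR44 := AdjoinRoot.powerBasis' f_monic

/-- `pb.dim = 4`. -/
theorem pb_dim : pb.dim = 4 := by
  show f.natDegree = 4
  exact f_natDegree

/-- `GR(4, 4)` is a finite `ℤ/4`-module (free on the power basis). -/
instance instModuleFiniteGR44 : Module.Finite (ZMod 4) GR44 := f_monic.finite_adjoinRoot

/-- `GR(4, 4)` is finite. -/
instance instFiniteGR44 : Finite GR44 := Module.finite_of_finite (ZMod 4)

/-- A `Fintype` instance on `GR(4, 4)` (classical). -/
instance instFintypeGR44 : Fintype GR44 := Fintype.ofFinite _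

/-- **`|GR(4, 4)| = 256 = 16²`** (`= octic_q.qK ^ 2`): the power basis has `4` elements over `ℤ/4`. -/
theorem card_GR44 : Fintype.card GR44 = 256 := by
  rw [Module.card_fintype pb.basis, ZMod.card, Fintype.card_fin, pb_dim]
  norm_num

/-- `|GR(4, 4)| = |𝔽₁₆|²`. -/
theorem card_GR44_eq_sq : Fintype.card GR44 = Fintype.card InertModel.F16 ^ 2 := by
  rw [card_GR44, InertModel.card_galoisField_two_four]
  rfl

end GaloisRing

end Summit.Ventures.HodgeRepro.PeriodCloser

end
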